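import Literature.Topology.FourManifolds.KirbyMovesSlideSweepPlanar
import HarnessLib

/-!
# Ambient isotopies from explicit trajectories: the flow fixes the zeros of the field

Topic `Literature/Topology/FourManifolds`; infrastructure for the fact seat
`provefact-IsStrictHandleSlide.isSurgery` (Kirby (1989), Ch. I §4–§5: the handle-slide sweep and
the normalisation of the band end are explicit compactly supported isotopies built from vector
fields with known trajectories). The tree's
`Literature.Topology.FourManifolds.exists_ambientIsotopy_of_hasDerivAt` (`KnotsInBall.lean`:
cut a smooth field off near a compact set of tracks and integrate) returns an ambient isotopy
realising prescribed trajectories and stationary off a compact subset of the chosen open set, but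
forgets one more piece of information available from the construction: **the isotopy fixes, at
all times, every point at which the given field vanishes at all times** (the cut-off field
vanishes there as well). This file re-runs the same proof and records it (no definitions, no named
facts):

* `Literature.Topology.FourManifolds.exists_ambientIsotopy_of_hasDerivAt_fix` — as
  `exists_ambientIsotopy_of_hasDerivAt`, with the additional conclusion
  `(∀ s, Y (s, z) = 0) → G t z = z`;
* `Literature.Topology.FourManifolds.exists_ambientIsotopy_rotationAbout` — **rotation about a
  point of the plane with radial cut-off**: for a centre `p`, a smooth angular profile `φ` of the
  squared distance with `φ = 0` beyond squared distance `τ²`, and a total angle `θ`, an ambient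
  isotopy `G` of the plane with `G t u = p + R(t θ φ(‖u - p‖²)) (u - p)` for all `u` and
  `0 ≤ t ≤ 1` (`R(α)` the rotation by `α`), equal to the identity off the disc `‖u - p‖ < τ`, and
  stationary off a compact set (the flow of the field `θ φ(‖u - p‖²) J (u - p)`, whose
  trajectories are the circles about `p`). Hirsch, *Differential Topology* (1976), Ch. 8 §1,
  Thms. 1.2–1.3.

## References

* M. W. Hirsch, *Differential Topology*, GTM 33, Springer (1976), Ch. 8 §1, Thms. 1.2–1.4.
  [HirschDT1976]
* R. C. Kirby, *The Topology of 4-Manifolds*, LNM 1374, Springer (1989), Ch. I §4. [Kirby1989]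
-/

open scoped Manifold ContDiff Topology
open Function Set Metric

noncomputable section

namespace Literature.Topology.FourManifolds

section Fix

variable {E : Type*} [NormedAddCommGroup E] [NormedSpace ℝ E] [FiniteDimensional ℝ E]
  [CompleteSpace E]

/-- **Isotopy extension for trajectories, with the zeros of the field fixed.** As
`exists_ambientIsotopy_of_hasDerivAt` (`KnotsInBall.lean`): `Y` a smooth time-dependent field,
`c x` solutions on `(-1, 2)` staying in the compact `K ⊆ U`; then there is an ambient isotopy `G`,
stationary off a compact subset of `U`, with `G t (c x 0) = c x t` on `[0, 1]` — and moreover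
`G t z = z` for every `z` with `Y (s, z) = 0` for all `s` (the cut-off field `ρ(s) χ(z) Y(s, z)`
vanishes at such `z`, so the flow fixes it: `tdFlow_eq_self_of_forall_eq_zero`).
[cite: HirschDT1976, Ch. 8 §1, Thms. 1.2–1.4] -/
theorem exists_ambientIsotopy_of_hasDerivAt_fix {Y : ℝ × E → E} (hY : ContDiff ℝ ∞ Y)
    {ι : Type*} {c : ι → ℝ → E} (hc : ∀ x, ∀ t ∈ Ioo (-1 : ℝ) 2, HasDerivAt (c x) (Y (t, c x t)) t)
    {K U : Set E} (hK : IsCompact K) (hU : IsOpen U) (hKU : K ⊆ U)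
    (hcK : ∀ x, ∀ t ∈ Ioo (-1 : ℝ) 2, c x t ∈ K) :
    ∃ G : AmbientIsotopy 𝓘(ℝ, E) E,
      (∃ C : Set E, IsCompact C ∧ C ⊆ U ∧ ∀ t, ∀ z ∉ C, G.toFun t z = z) ∧
      (∀ x, ∀ t ∈ Icc (0 : ℝ) 1, G.toFun t (c x 0) = c x t) ∧
      ∀ z, (∀ s, Y (s, z) = 0) → ∀ t, G.toFun t z = z := by
  obtain ⟨ρ, hρ, hρsupp, hρ1⟩ := exists_contDiff_time_cutoff
  obtain ⟨χ, hχ, hχ1, C, hC, hCU, hχ0⟩ := exists_contDiff_one_of_isCompact hK hU hKU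
  set X : ℝ × E → E := fun p ↦ (ρ p.1 * χ p.2) • Y p with hX_def
  have hX : ContDiff ℝ ∞ X :=
    ((hρ.comp contDiff_fst).mul (hχ.comp contDiff_snd)).smul hY
  have hXsupp : HasCompactSupport X := hasCompactSupport_smul_smul hρsupp hC hχ0
  refine ⟨AmbientIsotopy.ofField hX hXsupp, ⟨C, hC, hCU, fun t z hz ↦ ?_⟩, fun x t ht ↦ ?_,
    fun z hz t ↦ ?_⟩
  · rw [AmbientIsotopy.ofField_toFun]
    exact Literature.Analysis.ODE.tdFlow_eq_self_of_forall_eq_zero hX hXsupp (by simp)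
      (fun s ↦ by simp [X, hχ0 z hz]) 0 t
  · rw [AmbientIsotopy.ofField_toFun]
    have hode : ∀ s ∈ Ioo (-1 : ℝ) 2, HasDerivAt (c x) (X (s, c x s)) s := fun s hs ↦ by
      have h1 : X (s, c x s) = Y (s, c x s) := by
        simp [X, hρ1 s ⟨hs.1.le, hs.2.le⟩, hχ1 _ (hcK x s hs)]
      rw [h1]
      exact hc x s hs
    exact Literature.Analysis.ODE.tdFlow_eq_of_hasDerivAt hX hXsupp (by simp) (t₀ := 0)
      (by norm_num) hode ⟨by linarith [ht.1], by linarith [ht.2]⟩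
  · rw [AmbientIsotopy.ofField_toFun]
    exact Literature.Analysis.ODE.tdFlow_eq_self_of_forall_eq_zero hX hXsupp (by simp)
      (fun s ↦ by simp [X, hz s]) 0 t

end Fix

/-! ## Rotations about a point of the plane, with radial cut-off -/

namespace SlideSweep

/-- The quarter-turn `J (a, b) = (-b, a)` of the plane. [folklore] -/
theorem contDiff_quarterTurn :
    ContDiff ℝ ∞ fun u : EuclideanSpace ℝ (Fin 2) ↦
      (-(u 1)) • EuclideanSpace.single (0 : Fin 2) (1 : ℝ) + (u 0) • EuclideanSpace.single 1 1 :=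
  ((contDiff_apply 1).neg.smul contDiff_const).add ((contDiff_apply 0).smul contDiff_const)

/-- **Rotation about a point with radial cut-off.** Let `p` be a point of the plane, `θ : ℝ` an
angle, `τ > 0`, and `φ : ℝ → ℝ` smooth with `φ s = 0` for `s ≥ τ²`. Then there is an ambient isotopy
`G` of the plane such that for every `u` and `0 ≤ t ≤ 1`,
`G t u = p + cos α • (u - p) + sin α • J (u - p)` with `α = t θ φ(‖u - p‖²)` (the rotation about
`p` by `α`), `G t u = u` whenever `τ ≤ ‖u - p‖` (all `t`), and all stages are the identity off a
compact set: the flow of `u ↦ θ φ(‖u - p‖²) J (u - p)`, whose trajectories are the circles about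
`p` traversed at constant angular speed. Hirsch (1976), Ch. 8 §1, Thms. 1.2–1.3.
[cite: HirschDT1976, Ch. 8 §1, Thm. 1.3] -/
theorem exists_ambientIsotopy_rotationAbout (p : EuclideanSpace ℝ (Fin 2)) (θ : ℝ) {τ : ℝ}
    (hτ : 0 < τ) {φ : ℝ → ℝ} (hφ : ContDiff ℝ ∞ φ) (hφ0 : ∀ s, τ ^ 2 ≤ s → φ s = 0) :
    ∃ G : AmbientIsotopy 𝓘(ℝ, EuclideanSpace ℝ (Fin 2)) (EuclideanSpace ℝ (Fin 2)),
      (∃ C : Set (EuclideanSpace ℝ (Fin 2)), IsCompact C ∧ ∀ t, ∀ z ∉ C, G.toFun t z = z) ∧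
      (∀ (u : EuclideanSpace ℝ (Fin 2)), ∀ t ∈ Icc (0 : ℝ) 1,
        G.toFun t u = p + Real.cos (t * θ * φ (‖u - p‖ ^ 2)) • (u - p) +
          Real.sin (t * θ * φ (‖u - p‖ ^ 2)) •
            ((-((u - p) 1)) • EuclideanSpace.single (0 : Fin 2) (1 : ℝ) +
              ((u - p) 0) • EuclideanSpace.single 1 1)) ∧
      (∀ (u : EuclideanSpace ℝ (Fin 2)), τ ≤ ‖u - p‖ → ∀ t, G.toFun t u = u) := by
  set E0 : EuclideanSpace ℝ (Fin 2) := EuclideanSpace.single 0 1 with hE0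
  set E1 : EuclideanSpace ℝ (Fin 2) := EuclideanSpace.single 1 1 with hE1
  -- `J v = (-v₁, v₀)`
  set J : EuclideanSpace ℝ (Fin 2) → EuclideanSpace ℝ (Fin 2) := fun v ↦ (-(v 1)) • E0 + (v 0) • E1
    with hJ
  have hJ0 : ∀ v, J v 0 = -(v 1) := fun v ↦ by simp [J, E0, E1]
  have hJ1 : ∀ v, J v 1 = v 0 := fun v ↦ by simp [J, E0, E1]
  have hJlin_add : ∀ v w, J (v + w) = J v + J w := fun v w ↦ by
    ext i; fin_cases i <;> simp [J, E0, E1]; ring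
  have hJlin_smul : ∀ (a : ℝ) v, J (a • v) = a • J v := fun a v ↦ by
    ext i; fin_cases i <;> simp [J, E0, E1]
  have hJJ : ∀ v, J (J v) = -v := fun v ↦ by
    ext i; fin_cases i <;> simp [J, E0, E1]
  have hnormJ : ∀ v, ‖J v‖ = ‖v‖ := fun v ↦ by
    have hv : v = (v 0) • E0 + (v 1) • E1 := by ext i; fin_cases i <;> simp [E0, E1]
    conv_rhs => rw [hv, norm_smul_single_add_smul_single]
    rw [show J v = (-(v 1)) • E0 + (v 0) • E1 from rfl, norm_smul_single_add_smul_single]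
    congr 1; ring
  -- the angular profile as a function of the point
  set angS : EuclideanSpace ℝ (Fin 2) → ℝ := fun u ↦ θ * φ (‖u - p‖ ^ 2) with hangS
  have hangSs : ContDiff ℝ ∞ angS :=
    contDiff_const.mul (hφ.comp ((contDiff_norm_sq ℝ).comp (contDiff_id.sub contDiff_const)))
  -- the field
  set Y : ℝ × EuclideanSpace ℝ (Fin 2) → EuclideanSpace ℝ (Fin 2) := fun q ↦ angS q.2 • J (q.2 - p)
    with hY
  have hYs : ContDiff ℝ ∞ Y := by
    refine (hangSs.comp contDiff_snd).smul ?_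
    exact contDiff_quarterTurn.comp (contDiff_snd.sub contDiff_const)
  -- the trajectories: rotation about `p` at angular speed `angS u` (constant along the circle)
  set c : EuclideanSpace ℝ (Fin 2) → ℝ → EuclideanSpace ℝ (Fin 2) :=
    fun u t ↦ p + Real.cos (t * angS u) • (u - p) + Real.sin (t * angS u) • J (u - p) with hc
  have hnormc : ∀ u t, ‖c u t - p‖ = ‖u - p‖ := by
    intro u t
    have h1 : c u t - p = Real.cos (t * angS u) • (u - p) + Real.sin (t * angS u) • J (u - p) := by
      simp only [hc]; abel
    have hv : u - p = ((u - p) 0) • E0 + ((u - p) 1) • E1 := by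
      ext i; fin_cases i <;> simp [E0, E1]
    rw [h1]
    conv_rhs => rw [hv, norm_smul_single_add_smul_single]
    rw [show Real.cos (t * angS u) • (u - p) + Real.sin (t * angS u) • J (u - p) =
        (Real.cos (t * angS u) * (u - p) 0 - Real.sin (t * angS u) * (u - p) 1) • E0 +
        (Real.cos (t * angS u) * (u - p) 1 + Real.sin (t * angS u) * (u - p) 0) • E1 by
      conv_lhs => rw [hv]
      simp only [J, hE0, hE1]
      ext i; fin_cases i <;> simp; ring]
    rw [norm_smul_single_add_smul_single]
    congr 1
    nlinarith [Real.cos_sq_add_sin_sq (t * angS u)]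
  have hangSc : ∀ u t, angS (c u t) = angS u := fun u t ↦ by simp only [hangS, hnormc]
  have hderiv : ∀ u, ∀ t ∈ Ioo (-1 : ℝ) 2, HasDerivAt (c u) (Y (t, c u t)) t := by
    intro u t _
    have h1 : HasDerivAt (fun t : ℝ ↦ Real.cos (t * angS u)) (-Real.sin (t * angS u) * angS u) t := by
      simpa using ((hasDerivAt_id t).mul_const (angS u)).cos
    have h2 : HasDerivAt (fun t : ℝ ↦ Real.sin (t * angS u)) (Real.cos (t * angS u) * angS u) t := by
      simpa using ((hasDerivAt_id t).mul_const (angS u)).sin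
    have h := ((h1.smul_const (u - p)).const_add p).add (h2.smul_const (J (u - p)))
    have hval : Y (t, c u t) = (-Real.sin (t * angS u) * angS u) • (u - p) + (Real.cos (t * angS u) * angS u) • J (u - p) := by
      simp only [hY, hangSc]
      have : c u t - p = Real.cos (t * angS u) • (u - p) + Real.sin (t * angS u) • J (u - p) := by
        simp only [hc]; abel
      rw [this, hJlin_add, hJlin_smul, hJlin_smul, hJJ, smul_add, smul_smul, smul_smul, smul_neg]
      rw [show (-Real.sin (t * angS u) * angS u) • (u - p) = -((angS u * Real.sin (t * angS u)) • (u - p)) by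
        rw [← neg_smul]; congr 1; ring]
      rw [show Real.cos (t * angS u) * angS u = angS u * Real.cos (t * angS u) by ring]
      abel
    rw [hval]
    exact h
  -- tracks from the closed disc of radius `τ` about `p` stay in it
  have htrack : ∀ (u : closedBall p τ), ∀ t ∈ Ioo (-1 : ℝ) 2,
      c (u : EuclideanSpace ℝ (Fin 2)) t ∈ closedBall p τ := by
    intro u t _
    rw [mem_closedBall, dist_eq_norm, hnormc]
    have := u.2
    rwa [mem_closedBall, dist_eq_norm] at this
  obtain ⟨G, ⟨C, hC, -, hGC⟩, hG, hfix⟩ := exists_ambientIsotopy_of_hasDerivAt_fix hYs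
    (c := fun u : closedBall p τ ↦ c (u : EuclideanSpace ℝ (Fin 2)))
    (fun u t ht ↦ hderiv (u : EuclideanSpace ℝ (Fin 2)) t ht) (isCompact_closedBall p τ)
    isOpen_univ (subset_univ _) htrack
  -- points at distance `≥ τ` from `p` are zeros of the field
  have hzero : ∀ u : EuclideanSpace ℝ (Fin 2), τ ≤ ‖u - p‖ → ∀ s, Y (s, u) = 0 := by
    intro u hu s
    have hφu : φ (‖u - p‖ ^ 2) = 0 := hφ0 _ (by nlinarith [norm_nonneg (u - p)])
    simp only [hY, hangS, hφu, mul_zero, zero_smul]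
  have hc0 : ∀ u, c u 0 = u := fun u ↦ by simp [hc]
  refine ⟨G, ⟨C, hC, hGC⟩, fun u t ht ↦ ?_, fun u hu t ↦ hfix u (hzero u hu) t⟩
  by_cases hu : ‖u - p‖ ≤ τ
  · have h := hG ⟨u, by rw [mem_closedBall, dist_eq_norm]; exact hu⟩ t ht
    simp only [hc0] at h
    rw [h]
    simp only [hc, hangS, hJ, mul_assoc]
  · push Not at hu
    have hφu : φ (‖u - p‖ ^ 2) = 0 := hφ0 _ (by nlinarith [norm_nonneg (u - p)])
    rw [hfix u (hzero u hu.le) t, hφu]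
    simp

end SlideSweep

end Literature.Topology.FourManifolds
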